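import Summits.AnomalousDissipation.AnomalousDissipation.Theorems.SolenoidalFractalHomogenisationLagrangianCarrierConstructionTowerWindows
import Summits.AnomalousDissipation.AnomalousDissipation.Theorems.SolenoidalFractalHomogenisationLagrangianCarrierConstructionTowerCalculus
import HarnessLib

/-!
# K3L `LagrangianCarrierConstruction` (stmt-AnomalousDissipation-24913), line `birth`, stub `stub_flowsL`:
# the inductive step of the Lagrangian tower, III — the flow equation and the inserted velocity
# (helper; `--supports stmt-AnomalousDissipation-24913`)

Summits-side helper file (everything proved; no definitions, no named facts). For the window formula
`t ↦ A t (A s⁻¹ (φ(t, s, C z₀)))` of the Lagrangian tower (coarse absolute flow `A` with velocity `B`, Eulerian evolution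
`φ` of the next level field `v` from the window's left end `s`, accumulated map `C`):
* `hasDerivAt_window_formula` — the FLOW EQUATION of the next level: the time derivative is
  `B t (·) + D(A t ∘ A s⁻¹)(q) (v t q)` at `q = φ(t, s, C z₀)`, i.e. the coarse velocity plus the next Eulerian level
  PUSHED FORWARD by the relative coarse flow `X(t, s) = A t ∘ A s⁻¹` (the frozen-in transport of
  `LagrangianLatticeCarrier.IsInserted`), by the chain rule along a curve of `…TowerCalculus`;
* the inserted velocity `b' t z = D(X(t,s))(X(s,t) z) (v t (X(s,t) z))` is lattice periodic, bounded in terms of derivative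
  bounds of `A t`, `A s⁻¹` and the size of `v`, and jointly continuous where the coarse flow is two-sided smooth;
* derivative bounds for the window formula and its inverse (products of the factors' bounds), and for evolution maps on
  compact time ranges (from their Lipschitz constants).
Infrastructure for the construction side of route-1's rung leaf F-D1.A0 (a frontier formal rung); NOT a proof of anomalous
dissipation.
-/

set_option linter.dupNamespace false

noncomputable section

namespace Summit.AnomalousDissipation.AnomalousDissipation.Theorems.SolenoidalFractalHomogenisation.LagrangianCarrierConstruction

open Set Function Filter Topology Metric
open scoped NNReal
open Literature.Analysis.ODE Literature.Analysis.FunctionSpaces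

section FlowEquation

variable {V : Type*} [NormedAddCommGroup V] [NormedSpace ℝ V] [CompleteSpace V]
variable {v : ℝ → V → V}

/-- **The flow equation of the window formula.** [folklore] -/
theorem hasDerivAt_window_formula (hv : IsUniformlyLipschitzOn v univ) (A : ℝ → V ≃ V) (B : ℝ → V → V)
    {t : ℝ} (s : ℝ) (C : V ≃ V) (z₀ : V)
    (hAt : ∃ ε > 0, ContDiffOn ℝ 1 (fun p : ℝ × V => A p.1 p.2) (Icc (t - ε) (t + ε) ×ˢ univ))
    (h5 : ∀ z, HasDerivAt (fun τ => A τ z) (B t (A t z)) t)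
    (hAt1 : ContDiff ℝ 1 (A t)) (hAs : ContDiff ℝ 1 (A s).symm) :
    HasDerivAt (fun τ => A τ ((A s).symm (evolutionMap v s τ (C z₀))))
      (B t (A t ((A s).symm (evolutionMap v s t (C z₀)))) +
        fderiv ℝ (fun y => A t ((A s).symm y)) (evolutionMap v s t (C z₀)) (v t (evolutionMap v s t (C z₀)))) t := by
  obtain ⟨ε, hε, hA⟩ := hAt
  -- the fine trajectory read in the coarse frame
  have hζ : HasDerivAt (fun τ => (A s).symm (evolutionMap v s τ (C z₀)))
      (fderiv ℝ (A s).symm (evolutionMap v s t (C z₀)) (v t (evolutionMap v s t (C z₀)))) t :=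
    ((hAs.differentiable (by simp)) _).hasFDerivAt.comp_hasDerivAt t (hasDerivAt_evolutionMap_univ hv s t (C z₀))
  have hH : DifferentiableAt ℝ (fun p : ℝ × V => A p.1 p.2) (t, (A s).symm (evolutionMap v s t (C z₀))) := by
    have hmem : Icc (t - ε) (t + ε) ×ˢ (univ : Set V) ∈ 𝓝 (t, (A s).symm (evolutionMap v s t (C z₀))) :=
      prod_mem_nhds (Icc_mem_nhds (by linarith) (by linarith)) univ_mem
    exact (hA.contDiffAt hmem).differentiableAt (by simp)
  have h := hasDerivAt_comp_curve (H := fun τ y => A τ y) hH (h5 _) hζ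
  have hcomp : fderiv ℝ (fun y => A t ((A s).symm y)) (evolutionMap v s t (C z₀)) =
      (fderiv ℝ (A t) ((A s).symm (evolutionMap v s t (C z₀)))).comp
        (fderiv ℝ (A s).symm (evolutionMap v s t (C z₀))) :=
    fderiv_comp _ ((hAt1.differentiable (by simp)) _) ((hAs.differentiable (by simp)) _)
  rw [hcomp]
  exact h

end FlowEquation

section Inserted

variable {d : Type*} [Fintype d] [DecidableEq d]

/-- **The inserted velocity is lattice periodic.** [folklore] -/
theorem inserted_add_latticeVec (A : ℝ → EuclideanSpace ℝ d ≃ EuclideanSpace ℝ d)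
    (v : ℝ → EuclideanSpace ℝ d → EuclideanSpace ℝ d) (t s : ℝ)
    (hA : ∀ t z (k : d → ℤ), A t (z + Torus.latticeVec k) = A t z + Torus.latticeVec k)
    (hvper : ∀ t z (k : d → ℤ), v t (z + Torus.latticeVec k) = v t z) (z : EuclideanSpace ℝ d) (k : d → ℤ) :
    fderiv ℝ (fun y => A t ((A s).symm y)) (A s ((A t).symm (z + Torus.latticeVec k)))
        (v t (A s ((A t).symm (z + Torus.latticeVec k)))) =
      fderiv ℝ (fun y => A t ((A s).symm y)) (A s ((A t).symm z)) (v t (A s ((A t).symm z))) := by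
  have hq : A s ((A t).symm (z + Torus.latticeVec k)) = A s ((A t).symm z) + Torus.latticeVec k := by
    rw [equivariant_symm (hA t), hA]
  have hX : ∀ y (k : d → ℤ), A t ((A s).symm (y + Torus.latticeVec k)) = A t ((A s).symm y) + Torus.latticeVec k :=
    fun y k => by rw [equivariant_symm (hA s), hA]
  rw [hq, hvper, fderiv_add_latticeVec_of_equivariant hX]

variable {W : Type*} [NormedAddCommGroup W] [NormedSpace ℝ W]

/-- Operator-norm bound for the inserted velocity: `‖D(A t ∘ A s⁻¹)(q) w‖ ≤ K₁ K₂ ‖w‖`. [folklore] -/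
theorem norm_inserted_le (A : ℝ → W ≃ W) (t s : ℝ) (hAt1 : ContDiff ℝ 1 (A t)) (hAs : ContDiff ℝ 1 (A s).symm)
    {K₁ K₂ : ℝ} (hK₁ : ∀ y, ‖fderiv ℝ (A t) y‖ ≤ K₁) (hK₂ : ∀ y, ‖fderiv ℝ (fun x => (A s).symm x) y‖ ≤ K₂)
    (hK₁0 : 0 ≤ K₁) (q w : W) :
    ‖fderiv ℝ (fun y => A t ((A s).symm y)) q w‖ ≤ K₁ * K₂ * ‖w‖ := by
  have hcomp : fderiv ℝ (fun y => A t ((A s).symm y)) q =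
      (fderiv ℝ (A t) ((A s).symm q)).comp (fderiv ℝ (A s).symm q) :=
    fderiv_comp _ ((hAt1.differentiable (by simp)) _) ((hAs.differentiable (by simp)) _)
  rw [hcomp]
  calc ‖((fderiv ℝ (A t) ((A s).symm q)).comp (fderiv ℝ (A s).symm q)) w‖
      ≤ ‖(fderiv ℝ (A t) ((A s).symm q)).comp (fderiv ℝ (A s).symm q)‖ * ‖w‖ := ContinuousLinearMap.le_opNorm _ _
    _ ≤ ‖fderiv ℝ (A t) ((A s).symm q)‖ * ‖fderiv ℝ (A s).symm q‖ * ‖w‖ :=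
        mul_le_mul_of_nonneg_right (ContinuousLinearMap.opNorm_comp_le _ _) (norm_nonneg _)
    _ ≤ K₁ * K₂ * ‖w‖ := by
        refine mul_le_mul_of_nonneg_right ?_ (norm_nonneg _)
        exact mul_le_mul (hK₁ _) (hK₂ _) (norm_nonneg _) hK₁0

/-- **Joint continuity of the inserted velocity** `(t, z) ↦ D(A t ∘ A s⁻¹)(A s (A t⁻¹ z)) (v t (A s (A t⁻¹ z)))` at a time
where the coarse flow and its inverse are two-sided jointly `C¹` (fixed frame `s`). [folklore] -/
theorem continuousAt_inserted (A : ℝ → W ≃ W) (v : ℝ → W → W) {t : ℝ} (s : ℝ) (z : W)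
    (hAt : ∃ ε > 0, ContDiffOn ℝ 1 (fun p : ℝ × W => A p.1 p.2) (Icc (t - ε) (t + ε) ×ˢ univ))
    (hAt' : ∃ ε > 0, ContDiffOn ℝ 1 (fun p : ℝ × W => (A p.1).symm p.2) (Icc (t - ε) (t + ε) ×ˢ univ))
    (hA1 : ∀ τ, ContDiff ℝ 1 (A τ)) (hAs : ContDiff ℝ 1 (A s).symm) (hvc : Continuous (uncurry v)) :
    ContinuousAt (fun p : ℝ × W => fderiv ℝ (fun y => A p.1 ((A s).symm y)) (A s ((A p.1).symm p.2))
      (v p.1 (A s ((A p.1).symm p.2)))) (t, z) := by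
  obtain ⟨ε, hε, hA⟩ := hAt
  obtain ⟨ε', hε', hA'⟩ := hAt'
  -- expand the derivative of the composition pointwise
  have hexp : (fun p : ℝ × W => fderiv ℝ (fun y => A p.1 ((A s).symm y)) (A s ((A p.1).symm p.2))
      (v p.1 (A s ((A p.1).symm p.2)))) = fun p : ℝ × W =>
      (fderiv ℝ (A p.1) ((A s).symm (A s ((A p.1).symm p.2))))
        ((fderiv ℝ (A s).symm (A s ((A p.1).symm p.2))) (v p.1 (A s ((A p.1).symm p.2)))) := by
    funext p
    have e : fderiv ℝ (fun y => A p.1 ((A s).symm y)) (A s ((A p.1).symm p.2)) =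
        (fderiv ℝ (A p.1) ((A s).symm (A s ((A p.1).symm p.2)))).comp (fderiv ℝ (A s).symm (A s ((A p.1).symm p.2))) :=
      fderiv_comp _ (((hA1 p.1).differentiable (by simp)) _) ((hAs.differentiable (by simp)) _)
    rw [e]
    rfl
  rw [hexp]
  -- the frame point `q p = A s ((A p.1)⁻¹ p.2)` is jointly continuous
  have hsymm : ContinuousAt (fun p : ℝ × W => (A p.1).symm p.2) (t, z) :=
    (hA'.contDiffAt (prod_mem_nhds (Icc_mem_nhds (by linarith) (by linarith)) univ_mem)).continuousAt
  have hq : ContinuousAt (fun p : ℝ × W => A s ((A p.1).symm p.2)) (t, z) :=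
    ((hA1 s).continuous.continuousAt).comp hsymm
  have hy : ContinuousAt (fun p : ℝ × W => (A s).symm (A s ((A p.1).symm p.2))) (t, z) :=
    (hAs.continuous.continuousAt).comp hq
  -- the three ingredients
  have hL1 : ContinuousAt (fun p : ℝ × W => fderiv ℝ (A p.1) ((A s).symm (A s ((A p.1).symm p.2)))) (t, z) := by
    have hsl : ContinuousAt (fun q : ℝ × W => fderiv ℝ (A q.1) q.2) (t, (A s).symm (A s ((A t).symm z))) :=
      continuousAt_fderiv_slice (Φ := fun τ => ⇑(A τ))
        (hA.contDiffAt (prod_mem_nhds (Icc_mem_nhds (by linarith) (by linarith)) univ_mem)) le_rfl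
    exact ContinuousAt.comp_of_eq hsl (continuousAt_fst.prodMk hy) rfl
  have hL2 : ContinuousAt (fun p : ℝ × W => fderiv ℝ (A s).symm (A s ((A p.1).symm p.2))) (t, z) :=
    ((hAs.continuous_fderiv (by simp)).continuousAt).comp hq
  have hw : ContinuousAt (fun p : ℝ × W => v p.1 (A s ((A p.1).symm p.2))) (t, z) :=
    (hvc.continuousAt).comp (continuousAt_fst.prodMk hq)
  exact hL1.clm_apply (hL2.clm_apply hw)

end Inserted

section Bounds

variable {V : Type*} [NormedAddCommGroup V] [NormedSpace ℝ V] [CompleteSpace V]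
variable {v : ℝ → V → V}

/-- Derivative bounds for evolution maps on compact time ranges (from their Lipschitz constants). [folklore] -/
theorem exists_bound_fderiv_evolutionMap_Icc (hv : IsUniformlyLipschitzOn v univ) (a b : ℝ) :
    ∃ K : ℝ, 0 ≤ K ∧ ∀ s ∈ Icc a b, ∀ t ∈ Icc a b, ∀ z, ‖fderiv ℝ (evolutionMap v s t) z‖ ≤ K := by
  obtain ⟨K, hK⟩ := exists_lipschitzWith_evolutionMap_Icc hv a b
  exact ⟨K, K.2, fun s hs t ht z => norm_fderiv_le_of_lipschitz ℝ (hK s hs t ht)⟩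

omit [CompleteSpace V] in
/-- **Derivative bound for the window formula**: `‖D(A t ∘ A s⁻¹ ∘ φ ∘ C)‖ ≤ K₁ K₂ K₃ K₄`. [folklore] -/
theorem norm_fderiv_window_formula_le (A : ℝ → V ≃ V) (t s : ℝ) (φ : V → V) (C : V ≃ V)
    (hAt1 : ContDiff ℝ 1 (A t)) (hAs : ContDiff ℝ 1 (A s).symm) (hφ : ContDiff ℝ 1 φ) (hC : ContDiff ℝ 1 C)
    {K₁ K₂ K₃ K₄ : ℝ} (hK₁ : ∀ y, ‖fderiv ℝ (A t) y‖ ≤ K₁) (hK₂ : ∀ y, ‖fderiv ℝ (fun x => (A s).symm x) y‖ ≤ K₂)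
    (hK₃ : ∀ y, ‖fderiv ℝ φ y‖ ≤ K₃) (hK₄ : ∀ y, ‖fderiv ℝ (fun x => C x) y‖ ≤ K₄)
    (h₁ : 0 ≤ K₁) (h₂ : 0 ≤ K₂) (h₃ : 0 ≤ K₃) (z : V) :
    ‖fderiv ℝ (fun y => A t ((A s).symm (φ (C y)))) z‖ ≤ K₁ * K₂ * K₃ * K₄ := by
  have dA := (hAt1.differentiable (by simp)); have dS := (hAs.differentiable (by simp))
  have dφ := (hφ.differentiable (by simp)); have dC := (hC.differentiable (by simp))
  have e1 : fderiv ℝ (fun y => A t ((A s).symm (φ (C y)))) z =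
      (fderiv ℝ (A t) ((A s).symm (φ (C z)))).comp (fderiv ℝ (fun y => (A s).symm (φ (C y))) z) :=
    fderiv_comp z (dA _) ((dS _).comp z ((dφ _).comp z (dC _)))
  have e2 : fderiv ℝ (fun y => (A s).symm (φ (C y))) z =
      (fderiv ℝ (A s).symm (φ (C z))).comp (fderiv ℝ (fun y => φ (C y)) z) :=
    fderiv_comp z (dS _) ((dφ _).comp z (dC _))
  have e3 : fderiv ℝ (fun y => φ (C y)) z = (fderiv ℝ φ (C z)).comp (fderiv ℝ C z) := fderiv_comp z (dφ _) (dC _)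
  rw [e1, e2, e3]
  calc ‖(fderiv ℝ (A t) ((A s).symm (φ (C z)))).comp ((fderiv ℝ (A s).symm (φ (C z))).comp
        ((fderiv ℝ φ (C z)).comp (fderiv ℝ C z)))‖
      ≤ ‖fderiv ℝ (A t) ((A s).symm (φ (C z)))‖ * (‖fderiv ℝ (A s).symm (φ (C z))‖ *
          (‖fderiv ℝ φ (C z)‖ * ‖fderiv ℝ C z‖)) := by
        refine (ContinuousLinearMap.opNorm_comp_le _ _).trans (mul_le_mul_of_nonneg_left ?_ (norm_nonneg _))
        refine (ContinuousLinearMap.opNorm_comp_le _ _).trans (mul_le_mul_of_nonneg_left ?_ (norm_nonneg _))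
        exact ContinuousLinearMap.opNorm_comp_le _ _
    _ ≤ K₁ * (K₂ * (K₃ * K₄)) := by
        refine mul_le_mul (hK₁ _) ?_ (by positivity) h₁
        refine mul_le_mul (hK₂ _) ?_ (by positivity) h₂
        exact mul_le_mul (hK₃ _) (hK₄ _) (norm_nonneg _) h₃
    _ = K₁ * K₂ * K₃ * K₄ := by ring

end Bounds

end Summit.AnomalousDissipation.AnomalousDissipation.Theorems.SolenoidalFractalHomogenisation.LagrangianCarrierConstruction

end
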